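import Summits.Ventures.LatticeQCDFlow.Scoring.BlockFactorCLT
import Summits.Ventures.LatticeQCDFlow.Scoring.BlockFactorBartlett
import Summits.Ventures.LatticeQCDFlow.Scoring.MultivariateCLT

/-!
# The JOINT central limit theorem for the empirical autocovariances of a block-factor process: `√N ((Γ̂_N(t))_{t≤W} − (c(t))_{t≤W}) ⇒ N(0, Σ)`

HONEST FRAMING: exact (Metropolis-corrected) sampling algorithms for lattice gauge theory;
figures of merit are autocorrelation/cost numbers at stated couplings and volumes; no
continuum-physics claim.

Venture `LatticeQCDFlow` (cell pub-lqcd), sub-topic `Scoring`; FANOUT row 16 (`su2-base`), GEN-7.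
NEW WORK of the cell over `Scoring/BlockFactorCLT` (the `m`-dependent CLT), `Scoring/BlockFactorBartlett`
(`lagCov`, `lagProdACov`), row 4's `Scoring/CramerWoldDevice` and `Scoring/MultivariateCLT` (the algebra
`inner_normalisedSum_eq`), and GEN-6's `Scoring/LagProductCovariance` (`acovHat`); nothing is cited as a
fact.  Printed counterparts
NAMED ONLY: the joint asymptotic normality of sample autocovariances of a linear process (Bartlett
1946; Anderson 1971 Thm 8.4.2; Brockwell–Davis 1991 Prop. 7.3.1–7.3.4); Hoeffding–Robbins 1948 §5
(functions of `m`-dependent blocks).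

A file of the LAW-OF-THE-ERROR packet (after `BlockFactorCLT` and `BlockFactorBartlett`).  The Γ-method statistics of both frozen scorers are
smooth functions of the vector `(Γ̂_N(0), …, Γ̂_N(W))`; this file gives that vector's Gaussian limit.

## Contents

* **`tendstoInDistribution_blockFactor_vector`** — THE CLT FOR VECTOR-VALUED BLOCK FACTORS
  `Y_i = G(ξ_i, …, ξ_{i+m}) ∈ E` (finite-dimensional inner product space): for `Z` with
  `⟪a, Z⟫ ~ N(0, σ_a²)`, `σ_a²` the long-run variance of the real block factor `⟪a, Y_i⟫`,
  `(√N)⁻¹ • (Σ_{i<N} Y_i − N • E Y_0) ⇒ Z` (Cramér–Wold + `tendstoInDistribution_blockFactor`).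
* `lagProdMap F W` (the window map `w ↦ (F(w_{0..m}) F(w_{t..t+m}))_{t≤W} ∈ ℝ^{W+1}`),
  `lagProdMap_window` (it reads `(X_i X_{i+t})_{t≤W}`); with `BlockFactorBartlett`'s
  `lagCov X P s t k = cov[X_0X_s, X_kX_{k+t}]` and `lagProdACov X P K s t` (the asymptotic covariance
  MATRIX `Σ_K`): `covariance_inner_lagProdMap`, **`lrVar_inner_lagProdMap`** (the long-run variance of
  `⟪a, Y⟫` is the quadratic form `aᵀ Σ_{m+W} a`); `memLp_lagProdMap_window`, `integral_lagProdMap_window`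
  (`E Y_0 = (c(t))_t`, `c(t) = E[X_0 X_t]`).
* **`tendstoInDistribution_acovHat`** — THE JOINT CLT: `ξ` i.i.d., `X_i = F(ξ_i..ξ_{i+m})` with
  square-integrable lag products, `Z` with `⟪a, Z⟫ ~ N(0, aᵀ Σ_{m+W} a)` for all `a`; then
  `√N • ((Γ̂_N(t))_{t≤W} − (c(t))_{t≤W}) ⇒ Z` in `EuclideanSpace ℝ (Fin (W+1))`
  (`Γ̂_N(t) = acovHat X N t`, known mean, `1/N` normalisation — GEN-6's conventions).

NOT CLAIMED: existence of `Z` as a constructed Gaussian vector (any `Z` with the stated projections —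
Mathlib's `multivariateGaussian` provides one; not restated); positive-definiteness of `Σ`; mean
subtraction and the `1/(N−t)` normalisation (immaterial at this order: GEN-6
`AcovHatScorerNormalisation`, `MeanSubtractionBias`); rates.
-/

noncomputable section

open MeasureTheory ProbabilityTheory Filter Finset WithLp
open scoped Topology NNReal RealInnerProductSpace

namespace Summit.Ventures.LatticeQCDFlow.Scoring

/-! ## Vector-valued block factors: the CLT by Cramér–Wold -/

section Vector

variable {Ω : Type*} [MeasurableSpace Ω] {P : Measure Ω} [IsProbabilityMeasure P]
variable {Ω' : Type*} [MeasurableSpace Ω'] {P' : Measure Ω'} [IsProbabilityMeasure P']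
variable {S : Type*} [MeasurableSpace S] {ξ : ℕ → Ω → S} {m : ℕ}
variable {E : Type*} [NormedAddCommGroup E] [InnerProductSpace ℝ E] [FiniteDimensional ℝ E]
  [MeasurableSpace E] [BorelSpace E] {G : (Fin (m + 1) → S) → E}

/-- **THE CLT FOR VECTOR-VALUED BLOCK FACTORS.**  `ξ` i.i.d., `G` measurable into a
finite-dimensional inner product space, `Y_i = G(ξ_i, …, ξ_{i+m})` square integrable, `Z` a random
vector whose projection `⟪a, Z⟫` is `N(0, σ_a²)` with `σ_a²` the long-run variance of the scalar block
factor `⟪a, Y_i⟫`.  Then `(√N)⁻¹ • (Σ_{i<N} Y_i − N • E Y_0) ⇒ Z` (Cramér–Wold: each projection is a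
real block factor, `tendstoInDistribution_blockFactor`). -/
theorem tendstoInDistribution_blockFactor_vector (hξ : ∀ i, Measurable (ξ i))
    (hind : iIndepFun ξ P) (hid : ∀ i, IdentDistrib (ξ i) (ξ 0) P P) (hG : Measurable G)
    (h2 : MemLp (fun ω => G (window ξ (m + 1) 0 ω)) 2 P) {Z : Ω' → E} (hZm : AEMeasurable Z P')
    (hZ : ∀ a : E, HasLaw (fun ω' => ⟪a, Z ω'⟫) (gaussianReal 0
      (lrVar (fun k => cov[blockFactor (fun w => ⟪a, G w⟫) ξ 0,
        blockFactor (fun w => ⟪a, G w⟫) ξ k; P]) m).toNNReal) P') :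
    TendstoInDistribution
      (fun (N : ℕ) ω => (Real.sqrt N)⁻¹ • (∑ i ∈ range N, G (window ξ (m + 1) i ω)
        - (N : ℝ) • P[fun ω => G (window ξ (m + 1) 0 ω)]))
      atTop Z (fun _ => P) P' := by
  have hYm : ∀ i, Measurable fun ω => G (window ξ (m + 1) i ω) :=
    fun i => hG.comp (measurable_window hξ _ _)
  have hSm : ∀ N : ℕ, AEMeasurable (fun ω => (Real.sqrt N)⁻¹ • (∑ i ∈ range N,
      G (window ξ (m + 1) i ω) - (N : ℝ) • P[fun ω => G (window ξ (m + 1) 0 ω)])) P := fun N =>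
    (((Finset.measurable_sum _ fun i _ => hYm i).sub_const _).const_smul _).aemeasurable
  refine CardConsistency.tendstoInDistribution_of_forall_inner (P := fun _ => P) hSm hZm fun a => ?_
  -- the scalar block factor `⟪a, Y_i⟫`
  have hm : Measurable fun x : E => ⟪a, x⟫ := (continuous_const.inner continuous_id).measurable
  have hGa : Measurable fun w => ⟪a, G w⟫ := hm.comp hG
  have h2a : MemLp (blockFactor (fun w => ⟪a, G w⟫) ξ 0) 2 P := h2.const_inner a
  have hclt := tendstoInDistribution_blockFactor hξ hind hid hGa h2a (hZ a)
  have hmean : P[blockFactor (fun w => ⟪a, G w⟫) ξ 0] = ⟪a, P[fun ω => G (window ξ (m + 1) 0 ω)]⟫ :=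
    integral_inner (h2.integrable one_le_two) a
  refine hclt.congr (fun N => Eventually.of_forall fun ω => ?_) EventuallyEq.rfl
  beta_reduce at hmean ⊢
  rw [CardConsistency.inner_normalisedSum_eq, ← hmean, sum_sub_distrib, sum_const,
    card_range, nsmul_eq_mul]
  rfl

end Vector

/-! ## Lag products of a block-factor process -/

section LagProducts

variable {Ω : Type*} [MeasurableSpace Ω] {P : Measure Ω} [IsProbabilityMeasure P]
variable {Ω' : Type*} [MeasurableSpace Ω'] {P' : Measure Ω'} [IsProbabilityMeasure P']
variable {S : Type*} [MeasurableSpace S] {ξ : ℕ → Ω → S} {m : ℕ} {F : (Fin (m + 1) → S) → ℝ}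

/-- The vector of LAG PRODUCTS `(F(w_0..w_m) · F(w_t..w_{t+m}))_{t ≤ W}` read off one window of length
`m + W + 1` — so that `(X_i X_{i+t})_{t≤W}` is a vector-valued block factor of `ξ`. [ours] -/
def lagProdMap (F : (Fin (m + 1) → S) → ℝ) (W : ℕ) :
    (Fin (m + W + 1) → S) → EuclideanSpace ℝ (Fin (W + 1)) :=
  fun w => toLp 2 fun t : Fin (W + 1) =>
    F (fun j : Fin (m + 1) => w ⟨0 + j, by omega⟩) * F (fun j : Fin (m + 1) => w ⟨t + j, by omega⟩)

omit [MeasurableSpace Ω] in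
/-- `lagProdMap` is measurable. -/
theorem measurable_lagProdMap (hF : Measurable F) (W : ℕ) : Measurable (lagProdMap F W) := by
  refine (WithLp.measurable_toLp 2 _).comp (measurable_pi_lambda _ fun t => ?_)
  exact (hF.comp (measurable_pi_lambda _ fun _ => measurable_pi_apply _)).mul
    (hF.comp (measurable_pi_lambda _ fun _ => measurable_pi_apply _))

omit [MeasurableSpace Ω] [MeasurableSpace S] in
/-- Along the sequence, `lagProdMap` of the window at `i` IS the vector of lag products
`(X_i X_{i+t})_{t≤W}`. -/
theorem lagProdMap_window (F : (Fin (m + 1) → S) → ℝ) (ξ : ℕ → Ω → S) (W i : ℕ) (ω : Ω) :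
    lagProdMap F W (window ξ (m + W + 1) i ω)
      = toLp 2 fun t : Fin (W + 1) => blockFactor F ξ i ω * blockFactor F ξ (i + t) ω := by
  simp only [lagProdMap, blockFactor_apply, window_add, add_zero]

omit [MeasurableSpace Ω] [IsProbabilityMeasure P] [MeasurableSpace S] in
/-- The projection `⟪a, ·⟫` of the lag-product vector is the real block factor
`Σ_t a_t X_i X_{i+t}`. -/
theorem inner_lagProdMap_window (F : (Fin (m + 1) → S) → ℝ) (ξ : ℕ → Ω → S) (W : ℕ)
    (a : EuclideanSpace ℝ (Fin (W + 1))) (i : ℕ) (ω : Ω) :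
    blockFactor (fun w => ⟪a, lagProdMap F W w⟫) ξ i ω
      = ∑ t : Fin (W + 1), a t * (blockFactor F ξ i ω * blockFactor F ξ (i + t) ω) := by
  rw [blockFactor_apply, lagProdMap_window, PiLp.inner_apply]
  refine sum_congr rfl fun t _ => ?_
  simp only [RCLike.inner_apply, conj_trivial]
  ring

/-- The autocovariances of the projected block factor are the quadratic form of the lag-product
covariances: `cov[⟪a,Y_0⟫, ⟪a,Y_k⟫] = Σ_{s,t} a_s a_t L_{s,t}(k)`. -/
theorem covariance_inner_lagProdMap (hind : iIndepFun ξ P) (hid : ∀ i, IdentDistrib (ξ i) (ξ 0) P P)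
    (hF : Measurable F) (h4 : ∀ t, MemLp (fun ω => blockFactor F ξ 0 ω * blockFactor F ξ t ω) 2 P)
    (W : ℕ) (a : EuclideanSpace ℝ (Fin (W + 1))) (k : ℕ) :
    cov[blockFactor (fun w => ⟪a, lagProdMap F W w⟫) ξ 0,
        blockFactor (fun w => ⟪a, lagProdMap F W w⟫) ξ k; P]
      = ∑ s : Fin (W + 1), ∑ t : Fin (W + 1), a s * a t * lagCov (blockFactor F ξ) P s t k := by
  have hm : ∀ i (t : ℕ), MemLp (fun ω => blockFactor F ξ i ω * blockFactor F ξ (i + t) ω) 2 P := by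
    intro i t
    have hp := identDistrib_blockFactor_pair hind hid hF i t
    exact (hp.comp (u := fun q : ℝ × ℝ => q.1 * q.2) (by fun_prop)).symm.memLp_snd (h4 t)
  have e : ∀ i, blockFactor (fun w => ⟪a, lagProdMap F W w⟫) ξ i
      = fun ω => ∑ t : Fin (W + 1), a t * (blockFactor F ξ i ω * blockFactor F ξ (i + t) ω) := by
    intro i; funext ω; exact inner_lagProdMap_window F ξ W a i ω
  have hms : ∀ i (s : Fin (W + 1)),
      MemLp (fun ω => a s * (blockFactor F ξ i ω * blockFactor F ξ (i + s) ω)) 2 P :=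
    fun i s => (hm i s).const_mul (a s)
  rw [e 0, e k, covariance_fun_sum_fun_sum (hms 0) (hms k)]
  refine sum_congr rfl fun s _ => sum_congr rfl fun t _ => ?_
  rw [covariance_const_mul_left, covariance_const_mul_right, lagCov]
  simp only [zero_add, mul_assoc]

/-- **The long-run variance of the projection is the quadratic form of `Σ_K`**:
`lrVar (k ↦ cov[⟪a,Y_0⟫, ⟪a,Y_k⟫]) K = Σ_{s,t} a_s a_t Σ_K(s,t)`. -/
theorem lrVar_inner_lagProdMap (hind : iIndepFun ξ P) (hid : ∀ i, IdentDistrib (ξ i) (ξ 0) P P)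
    (hF : Measurable F) (h4 : ∀ t, MemLp (fun ω => blockFactor F ξ 0 ω * blockFactor F ξ t ω) 2 P)
    (W K : ℕ) (a : EuclideanSpace ℝ (Fin (W + 1))) :
    lrVar (fun k => cov[blockFactor (fun w => ⟪a, lagProdMap F W w⟫) ξ 0,
        blockFactor (fun w => ⟪a, lagProdMap F W w⟫) ξ k; P]) K
      = ∑ s : Fin (W + 1), ∑ t : Fin (W + 1), a s * a t * lagProdACov (blockFactor F ξ) P K s t := by
  simp only [lrVar, covariance_inner_lagProdMap hind hid hF h4]
  -- symmetrise the cross terms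
  have hsym : ∀ k, ∑ s : Fin (W + 1), ∑ t : Fin (W + 1), a s * a t * lagCov (blockFactor F ξ) P t s k
      = ∑ s : Fin (W + 1), ∑ t : Fin (W + 1), a s * a t * lagCov (blockFactor F ξ) P s t k := by
    intro k
    rw [sum_comm]
    exact sum_congr rfl fun s _ => sum_congr rfl fun t _ => by ring
  have h1 : ∀ s t : Fin (W + 1), a s * a t * lagProdACov (blockFactor F ξ) P K s t
      = a s * a t * lagCov (blockFactor F ξ) P s t 0
        + ∑ k ∈ range K, (a s * a t * lagCov (blockFactor F ξ) P s t (k + 1)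
          + a s * a t * lagCov (blockFactor F ξ) P t s (k + 1)) := by
    intro s t
    simp only [lagProdACov, mul_add, mul_sum]
  simp only [h1, sum_add_distrib]
  congr 1
  simp only [Finset.sum_comm (s := (univ : Finset (Fin (W + 1)))) (t := range K), hsym]
  ring

/-- A vector of `EuclideanSpace ℝ (Fin (W+1))` is the sum of its coordinates times the standard
basis. -/
theorem toLp_eq_sum_smul_basisFun (W : ℕ) (v : Fin (W + 1) → ℝ) :
    toLp 2 v = ∑ t : Fin (W + 1), v t • EuclideanSpace.basisFun (Fin (W + 1)) ℝ t :=
  ((EuclideanSpace.basisFun (Fin (W + 1)) ℝ).sum_repr (toLp 2 v)).symm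

omit [IsProbabilityMeasure P] in
/-- A square-integrable real function times a constant vector is square integrable. -/
theorem memLp_smul_const {f : Ω → ℝ} (hf : MemLp f 2 P) {W : ℕ} (c : EuclideanSpace ℝ (Fin (W + 1))) :
    MemLp (fun ω => f ω • c) 2 P :=
  MemLp.of_le_mul (c := ‖c‖) hf (hf.1.smul_const c)
    (Eventually.of_forall fun ω => by rw [norm_smul, mul_comm])

omit [MeasurableSpace S] [IsProbabilityMeasure P] in
/-- The lag-product vector at position `0` is square integrable when every lag product is. -/
theorem memLp_lagProdMap_window
    (h4 : ∀ t, MemLp (fun ω => blockFactor F ξ 0 ω * blockFactor F ξ t ω) 2 P) (W : ℕ) :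
    MemLp (fun ω => lagProdMap F W (window ξ (m + W + 1) 0 ω)) 2 P := by
  have e : (fun ω => lagProdMap F W (window ξ (m + W + 1) 0 ω))
      = fun ω => ∑ t : Fin (W + 1), (blockFactor F ξ 0 ω * blockFactor F ξ (0 + t) ω)
          • EuclideanSpace.basisFun (Fin (W + 1)) ℝ t := by
    funext ω
    rw [lagProdMap_window, toLp_eq_sum_smul_basisFun]
  rw [e]
  refine memLp_finsetSum _ fun t _ => memLp_smul_const ?_ _
  simpa only [zero_add] using h4 t

omit [MeasurableSpace S] in
/-- The mean of the lag-product vector is the vector of autocovariances-at-known-mean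
`c(t) = E[X_0 X_t]`. -/
theorem integral_lagProdMap_window
    (h4 : ∀ t, MemLp (fun ω => blockFactor F ξ 0 ω * blockFactor F ξ t ω) 2 P) (W : ℕ) :
    P[fun ω => lagProdMap F W (window ξ (m + W + 1) 0 ω)]
      = toLp 2 fun t : Fin (W + 1) => P[fun ω => blockFactor F ξ 0 ω * blockFactor F ξ t ω] := by
  have e : (fun ω => lagProdMap F W (window ξ (m + W + 1) 0 ω))
      = fun ω => ∑ t : Fin (W + 1), (blockFactor F ξ 0 ω * blockFactor F ξ (0 + t) ω)
          • EuclideanSpace.basisFun (Fin (W + 1)) ℝ t := by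
    funext ω
    rw [lagProdMap_window, toLp_eq_sum_smul_basisFun]
  have hi : ∀ t : Fin (W + 1),
      Integrable (fun ω => blockFactor F ξ 0 ω * blockFactor F ξ (0 + t) ω) P := fun t => by
    simpa only [zero_add] using (h4 t).integrable one_le_two
  rw [e, integral_finsetSum _ fun t _ => (hi t).smul_const _, toLp_eq_sum_smul_basisFun]
  refine sum_congr rfl fun t _ => ?_
  rw [integral_smul_const]
  simp only [zero_add]

/-- **THE JOINT CLT FOR THE EMPIRICAL AUTOCOVARIANCES (known mean) OF A BLOCK-FACTOR PROCESS.**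
`ξ` i.i.d., `X_i = F(ξ_i, …, ξ_{i+m})` with square-integrable lag products, `W` a window,
`Γ̂_N(t) = (1/N) Σ_{i<N} X_i X_{i+t}` (`Scoring.acovHat`), `c(t) = E[X_0 X_t]`, and `Z` a random vector
of `ℝ^{W+1}` with `⟪a, Z⟫ ~ N(0, aᵀ Σ a)` for the matrix `Σ = lagProdACov X (m + W)`
(`Σ(s,t) = Σ_{|k| ≤ m+W} cov[X_0X_s, X_kX_{k+t}]`).  Then
`√N • ((Γ̂_N(t))_{t≤W} − (c(t))_{t≤W}) ⇒ Z` in distribution. -/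
theorem tendstoInDistribution_acovHat (hξ : ∀ i, Measurable (ξ i)) (hind : iIndepFun ξ P)
    (hid : ∀ i, IdentDistrib (ξ i) (ξ 0) P P) (hF : Measurable F)
    (h4 : ∀ t, MemLp (fun ω => blockFactor F ξ 0 ω * blockFactor F ξ t ω) 2 P) (W : ℕ)
    {Z : Ω' → EuclideanSpace ℝ (Fin (W + 1))} (hZm : AEMeasurable Z P')
    (hZ : ∀ a : EuclideanSpace ℝ (Fin (W + 1)), HasLaw (fun ω' => ⟪a, Z ω'⟫) (gaussianReal 0
      (∑ s : Fin (W + 1), ∑ t : Fin (W + 1),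
        a s * a t * lagProdACov (blockFactor F ξ) P (m + W) s t).toNNReal) P') :
    TendstoInDistribution
      (fun (N : ℕ) ω => Real.sqrt N • (toLp 2 (fun t : Fin (W + 1) => acovHat (blockFactor F ξ) N t ω)
        - toLp 2 (fun t : Fin (W + 1) => P[fun ω => blockFactor F ξ 0 ω * blockFactor F ξ t ω])))
      atTop Z (fun _ => P) P' := by
  have hZ' : ∀ a : EuclideanSpace ℝ (Fin (W + 1)), HasLaw (fun ω' => ⟪a, Z ω'⟫) (gaussianReal 0
      (lrVar (fun k => cov[blockFactor (fun w => ⟪a, lagProdMap F W w⟫) ξ 0,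
        blockFactor (fun w => ⟪a, lagProdMap F W w⟫) ξ k; P]) (m + W)).toNNReal) P' := by
    intro a
    rw [lrVar_inner_lagProdMap hind hid hF h4]
    exact hZ a
  have h := tendstoInDistribution_blockFactor_vector (m := m + W) hξ hind hid
    (measurable_lagProdMap hF W) (memLp_lagProdMap_window h4 W) hZm hZ'
  rw [integral_lagProdMap_window h4 W] at h
  refine h.congr (fun N => Eventually.of_forall fun ω => ?_) EventuallyEq.rfl
  simp only [lagProdMap_window]
  -- coordinatewise: `(√N)⁻¹ (S − N c) = √N (S/N − c)`
  rw [WithLp.ext_iff]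
  funext t
  simp only [WithLp.ofLp_smul, WithLp.ofLp_sub, WithLp.ofLp_sum, Pi.smul_apply, Pi.sub_apply,
    Finset.sum_apply, smul_eq_mul, acovHat_apply]
  rcases Nat.eq_zero_or_pos N with hN | hN
  · subst hN; simp
  · have hNpos : (0 : ℝ) < N := Nat.cast_pos.2 hN
    set S := ∑ x ∈ range N, blockFactor F ξ x ω * blockFactor F ξ (x + t) ω with hS
    set sN := Real.sqrt (N : ℝ) with hsN
    have hs0 : sN ≠ 0 := Real.sqrt_ne_zero'.2 hNpos
    have hN2 : (N : ℝ) = sN ^ 2 := by rw [hsN, Real.sq_sqrt hNpos.le]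
    rw [hN2]
    field_simp

end LagProducts

end Summit.Ventures.LatticeQCDFlow.Scoring

end

noncomputable section

open MeasureTheory ProbabilityTheory Filter Finset WithLp
open scoped Topology NNReal RealInnerProductSpace

namespace Summit.Ventures.LatticeQCDFlow.Scoring

/-! ## Appendix (GEN-8, appended) — lag by lag, with no limit object to supply: `√N (Γ̂_N(t) − c(t)) ⇒ N(0, Σ(t,t))`

The joint statement above is consumed through a random vector `Z` with prescribed Gaussian
projections, whose construction it leaves to the reader (Mathlib's `multivariateGaussian`).  For ONE
lag no construction is needed: the lag-`t` product series `X_i X_{i+t}` is itself a real block factor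
(`lagProdFactor`, windows of length `m + W + 1`), its long-run variance is the DIAGONAL ENTRY
`Σ_{m+W}(t,t) = Σ_{|k| ≤ m+W} cov[X_0X_t, X_kX_{k+t}]` of the asymptotic covariance matrix — Bartlett's
variance of a single sample autocovariance, here with no Gaussian/linear-process assumption — and the
scalar `m`-dependent CLT applies verbatim: the form an error bar on one `Γ̂_N(t)` rests on. -/

section PerLag

variable {Ω : Type*} [MeasurableSpace Ω] {P : Measure Ω} [IsProbabilityMeasure P]
variable {Ω' : Type*} [MeasurableSpace Ω'] {P' : Measure Ω'} [IsProbabilityMeasure P']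
variable {S : Type*} [MeasurableSpace S] {ξ : ℕ → Ω → S} {m : ℕ} {F : (Fin (m + 1) → S) → ℝ}

/-- **The long-run variance of the lag-`t` product series is the diagonal entry `Σ_{m+W}(t,t)`**:
`lrVar (k ↦ cov[X_0X_t, X_kX_{k+t}]) (m + W) = lagProdACov X (m + W) t t`. -/
theorem lrVar_lagProd (hind : iIndepFun ξ P) (hid : ∀ i, IdentDistrib (ξ i) (ξ 0) P P)
    (hF : Measurable F) (h4 : ∀ t, MemLp (fun ω => blockFactor F ξ 0 ω * blockFactor F ξ t ω) 2 P)
    {W : ℕ} (t : Fin (W + 1)) :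
    lrVar (fun k => cov[blockFactor (lagProdFactor F W t) ξ 0,
        blockFactor (lagProdFactor F W t) ξ k; P]) (m + W)
      = lagProdACov (blockFactor F ξ) P (m + W) t t := by
  have hk : ∀ k, cov[blockFactor (lagProdFactor F W t) ξ 0, blockFactor (lagProdFactor F W t) ξ k; P]
      = lagCov (blockFactor F ξ) P t t k := by
    intro k
    simpa only [blockFactor_lagProdFactor, zero_add] using
      covariance_lagProd_add hind hid hF h4 t t 0 k
  simp only [lrVar, hk, lagProdACov, two_mul, sum_add_distrib]

/-- **Bartlett's variance is non-negative**: `0 ≤ Σ_{m+W}(t,t)` (it is a long-run variance,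
`lrVar_nonneg`). -/
theorem lagProdACov_diag_nonneg (hξ : ∀ i, Measurable (ξ i)) (hind : iIndepFun ξ P)
    (hid : ∀ i, IdentDistrib (ξ i) (ξ 0) P P) (hF : Measurable F)
    (h4 : ∀ t, MemLp (fun ω => blockFactor F ξ 0 ω * blockFactor F ξ t ω) 2 P)
    {W : ℕ} (t : Fin (W + 1)) :
    0 ≤ lagProdACov (blockFactor F ξ) P (m + W) t t := by
  rw [← lrVar_lagProd hind hid hF h4 t]
  refine lrVar_nonneg (m := m + W) hξ hind hid (measurable_lagProdFactor hF W t) ?_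
  rw [blockFactor_lagProdFactor]
  simpa only [zero_add] using h4 t

/-- **THE CLT FOR ONE EMPIRICAL AUTOCOVARIANCE (known mean), Bartlett's variance.**  `ξ` i.i.d.,
`X_i = F(ξ_i, …, ξ_{i+m})` with square-integrable lag products, `t ≤ W`, `c(t) = E[X_0 X_t]`, and `Y`
ANY real random variable with law `N(0, Σ_{m+W}(t,t))`.  Then `√N (Γ̂_N(t) − c(t)) ⇒ Y`. -/
theorem tendstoInDistribution_acovHat_lag (hξ : ∀ i, Measurable (ξ i)) (hind : iIndepFun ξ P)
    (hid : ∀ i, IdentDistrib (ξ i) (ξ 0) P P) (hF : Measurable F)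
    (h4 : ∀ t, MemLp (fun ω => blockFactor F ξ 0 ω * blockFactor F ξ t ω) 2 P)
    {W : ℕ} (t : Fin (W + 1)) {Y : Ω' → ℝ}
    (hY : HasLaw Y (gaussianReal 0 (lagProdACov (blockFactor F ξ) P (m + W) t t).toNNReal) P') :
    TendstoInDistribution
      (fun (N : ℕ) ω => Real.sqrt N * (acovHat (blockFactor F ξ) N t ω
        - P[fun ω => blockFactor F ξ 0 ω * blockFactor F ξ t ω]))
      atTop Y (fun _ => P) P' := by
  have h2 : MemLp (blockFactor (lagProdFactor F W t) ξ 0) 2 P := by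
    rw [blockFactor_lagProdFactor]; simpa only [zero_add] using h4 t
  rw [← lrVar_lagProd hind hid hF h4 t] at hY
  have h := tendstoInDistribution_blockFactor (m := m + W) hξ hind hid
    (measurable_lagProdFactor hF W t) h2 hY
  refine h.congr (fun N => Eventually.of_forall fun ω => ?_) EventuallyEq.rfl
  simp only [blockFactor_lagProdFactor, zero_add, acovHat_apply, sum_sub_distrib, sum_const, card_range,
    nsmul_eq_mul]
  rcases Nat.eq_zero_or_pos N with hN | hN
  · subst hN; simp
  · have hNpos : (0 : ℝ) < N := Nat.cast_pos.2 hN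
    set SN := ∑ x ∈ range N, blockFactor F ξ x ω * blockFactor F ξ (x + t) ω
    set sN := Real.sqrt (N : ℝ) with hsN
    have hs0 : sN ≠ 0 := Real.sqrt_ne_zero'.2 hNpos
    have hN2 : (N : ℝ) = sN ^ 2 := by rw [hsN, Real.sq_sqrt hNpos.le]
    rw [hN2]
    field_simp

/-- **The same with NO limit object at all**: the laws of `√N (Γ̂_N(t) − c(t))` converge to
`gaussianReal 0 Σ_{m+W}(t,t)` — stated as convergence in distribution to the identity of
`(ℝ, N(0, Σ(t,t)))`. -/
theorem tendstoInDistribution_acovHat_lag_gaussianReal (hξ : ∀ i, Measurable (ξ i))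
    (hind : iIndepFun ξ P) (hid : ∀ i, IdentDistrib (ξ i) (ξ 0) P P) (hF : Measurable F)
    (h4 : ∀ t, MemLp (fun ω => blockFactor F ξ 0 ω * blockFactor F ξ t ω) 2 P)
    {W : ℕ} (t : Fin (W + 1)) :
    TendstoInDistribution
      (fun (N : ℕ) ω => Real.sqrt N * (acovHat (blockFactor F ξ) N t ω
        - P[fun ω => blockFactor F ξ 0 ω * blockFactor F ξ t ω]))
      atTop id (fun _ => P) (gaussianReal 0 (lagProdACov (blockFactor F ξ) P (m + W) t t).toNNReal) :=
  tendstoInDistribution_acovHat_lag hξ hind hid hF h4 t HasLaw.id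

/-- **The variance estimate**: at lag `0`, `√N (Γ̂_N(0) − E[X_0²]) ⇒ N(0, Σ_{m+W}(0,0))` with
`Σ(0,0) = Σ_{|k| ≤ m+W} cov[X_0², X_k²]` — the error bar of the `C(0)` both scorers divide by. -/
theorem tendstoInDistribution_acovHat_zero (hξ : ∀ i, Measurable (ξ i)) (hind : iIndepFun ξ P)
    (hid : ∀ i, IdentDistrib (ξ i) (ξ 0) P P) (hF : Measurable F)
    (h4 : ∀ t, MemLp (fun ω => blockFactor F ξ 0 ω * blockFactor F ξ t ω) 2 P) (W : ℕ)
    {Y : Ω' → ℝ}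
    (hY : HasLaw Y (gaussianReal 0 (lagProdACov (blockFactor F ξ) P (m + W) 0 0).toNNReal) P') :
    TendstoInDistribution
      (fun (N : ℕ) ω => Real.sqrt N * (acovHat (blockFactor F ξ) N 0 ω
        - P[fun ω => blockFactor F ξ 0 ω ^ 2]))
      atTop Y (fun _ => P) P' := by
  have h := tendstoInDistribution_acovHat_lag hξ hind hid hF h4 (W := W) 0 (Y := Y)
    (by simpa only [Fin.val_zero] using hY)
  simpa only [Fin.val_zero, pow_two] using h

end PerLag

end Summit.Ventures.LatticeQCDFlow.Scoring

end
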